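import Literature.Computability.QuantumComplexity.PPPostBQPCoreAmplitude
import Literature.Computability.Cryptography.PostselectionPostBQPProofs
import HarnessLib

/-!
# `PP ⊆ PostBQP`, VIII: the measured events of the quantum core and their probabilities

Topic `Literature/Computability/QuantumComplexity`; eighth file of the series proving Aaronson's
`PP ⊆ PostBQP` (Proc. R. Soc. A 461 (2005), Thm. 4; plan in `PPPostBQPScales.lean`). The
post-selection and the decision of the final `PostBQP` family are classical functions of the
string measured at the end of the quantum core (Aaronson, §3: "intermediate postselection steps
do not increase the power of `PostBQP` … at the end, we compute the AND of the ancilla qubits",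
and Bremner–Jozsa–Shepherd, §2.4: "for any register of `k` lines we may adjoin a circuit that
computes some simple function"). This file defines these events **on strings** and computes
their probabilities under the output kernel of `Core.family`:

* `Core.Ev Q n b` — the strings whose sign positions `n … n+K-1` all read `b`, whose body
  positions read `0`, and whose result zone reads the indicator of the `true`-code wires of the
  first `K` cells; `ofFn_mem_Ev_iff` identifies it with the register event `InEvent x (fun _ => b)`
  of file VI;
* `kernelProb_Ev_false = κ · plusW`, `kernelProb_Ev_true = κ · minusW` (file VI),
  `kernelProb_Ev_union`, and the complement rule `kernelProb_compl` (unitarity of Clifford+T);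
* so the post-selection weight `κ (plusW + minusW)` and the joint weight `κ · plusW` satisfy the
  thresholds of `PostBQP` by the product test of file III (`cond_ge_two_thirds`, `cond_le_one_third`,
  `post_pos`).

## References

* S. Aaronson, *Quantum computing, postselection, and probabilistic polynomial-time*, Proc. R.
  Soc. A 461 (2005) 3473–3482, arXiv:quant-ph/0412187: Def. 1, §3 (single-qubit post-selection
  by an AND of flags), Thm. 4 (proof).
* M. J. Bremner, R. Jozsa, D. J. Shepherd, Proc. R. Soc. A 467 (2011), §2.4 (post-selection
  registers of several lines).
* M. A. Nielsen, I. L. Chuang, *Quantum Computation and Quantum Information*, CUP 2010, §2.2.5.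
-/

noncomputable section

namespace Literature.Computability.QuantumComplexity

namespace PPPostBQP

namespace Core

open Complexity Cryptography RevSim RevClean CWrap _root_.Computability Finset Cryptography.PostBPPSim

variable {Q : Core} (x : List Bool)

/-! ### The events on strings -/

/-- **The event of the constant sign pattern `b`, on measured strings** (positions as in the
layout of `Core`): sign positions all `b`, body positions `0`, result zone equal to the
indicator of the `true`-code wires of the first `K` cells. [cite: Aaronson2005, Thm. 4 (proof: postselect on |0…0⟩)] -/
def Ev (Q : Core) (n : ℕ) (b : Bool) : Set (List Bool) :=
  {l | (∀ j < Q.K n, l.getD (n + j) false = b) ∧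
    (∀ i, n + Q.K n ≤ i → i < n + Q.rho n → l.getD i false = false) ∧
    (∀ i, Q.resStart n ≤ i → i < Q.resStart n + Q.resLen n →
      l.getD i false = decide (∃ j < Q.K n, i = resW Q.e Q.M (Q.nT n) j (symTrue Q.M)))}

/-- Reading a register label through its string. [folklore] -/
theorem getD_ofFn {W : ℕ} (y : QReg W) {i : ℕ} (hi : i < W) : (List.ofFn y).getD i false = y ⟨i, hi⟩ := by
  rw [List.getD_eq_getElem _ _ (by simpa using hi), List.getElem_ofFn]

/-- **The string event is the register event.** [folklore] -/
theorem ofFn_mem_Ev_iff (b : Bool) (y : QReg (x.length + Q.anc x.length)) :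
    List.ofFn y ∈ Ev Q x.length b ↔ InEvent x (fun _ => b) y := by
  have hW := Q.n_add_anc x.length
  have hres := Q.resStart_add_resLen_le x.length
  have hrho : x.length + Q.rho x.length ≤ x.length + Q.anc x.length := by
    have := Q.n0_le_W x.length; unfold n0 at this; omega
  constructor
  · rintro ⟨hs, hb, hr⟩
    refine ⟨fun q hq => ?_, fun j q hq => ?_⟩
    · rw [mem_S2_iff] at hq
      rcases hq with ⟨h1, h2⟩ | ⟨h1, h2⟩
      · rw [← getD_ofFn y q.isLt, hb q h1 h2]
        symm; rw [decide_eq_false_iff_not]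
        rintro ⟨j, hj, hjq⟩
        have := (resW_lt_of_lt x hj (symTrue Q.M)).1
        have h3 := Q.nT_le_resStart x.length
        unfold nT n0 at h3; omega
      · rw [← getD_ofFn y q.isLt, hr q h1 h2]; rfl
    · rw [← getD_ofFn y q.isLt]; simp only [hq]; rw [hs j j.isLt]
  · rintro ⟨hS, hs⟩
    refine ⟨fun j hj => ?_, fun i h1 h2 => ?_, fun i h1 h2 => ?_⟩
    · have hlt : x.length + j < x.length + Q.anc x.length := by unfold rho at hrho; omega
      rw [getD_ofFn y hlt]
      exact hs ⟨j, hj⟩ ⟨_, hlt⟩ rfl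
    · have hlt : i < x.length + Q.anc x.length := by omega
      rw [getD_ofFn y hlt, hS ⟨i, hlt⟩ ((mem_S2_iff x _).2 (Or.inl ⟨h1, h2⟩)), decide_eq_false_iff_not]
      rintro ⟨j, hj, hji⟩
      have := (resW_lt_of_lt x hj (symTrue Q.M)).1
      have h3 := Q.nT_le_resStart x.length
      simp only at hji; unfold nT n0 at h3; omega
    · have hlt : i < x.length + Q.anc x.length := by omega
      rw [getD_ofFn y hlt, hS ⟨i, hlt⟩ ((mem_S2_iff x _).2 (Or.inr ⟨h1, h2⟩))]
      rfl

/-- The two sign patterns are disjoint events (there is at least one sign position, `K ≥ 2`). [folklore] -/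
theorem not_mem_Ev_true_of_mem_Ev_false {n : ℕ} {l : List Bool} (h : l ∈ Ev Q n false) : l ∉ Ev Q n true := by
  intro h'
  have h1 := h.1 0 (by unfold K; omega)
  have h2 := h'.1 0 (by unfold K; omega)
  rw [h1] at h2
  exact Bool.false_ne_true h2

/-! ### Kernel probabilities of the core family -/

/-- The kernel of the core family as the Born sum of the register event. [cite: NielsenChuang2010, §2.2.5] -/
theorem kernelProb_Ev (b : Bool) :
    Q.family.kernelProb 0 x (Ev Q x.length b) =
      ∑ y : QReg (x.length + Q.anc x.length), (if InEvent x (fun _ => b) y then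
        ‖(Q.circ x.length).runOn 0 (basisState (padInput x.get (Q.anc x.length))) y‖ ^ 2 else 0) := by
  classical
  rw [kernelProb_eq_sum]
  refine Finset.sum_congr rfl fun y _ => ?_
  have h := ofFn_mem_Ev_iff x b y
  by_cases hy : InEvent x (fun _ => b) y
  · rw [if_pos (h.2 hy), if_pos hy]
  · rw [if_neg (fun h' => hy (h.1 h')), if_neg hy]

/-- **The probability of "all signs `0`"**: `κ · plusW`. [cite: Aaronson2005, Thm. 4 (proof)] -/
theorem kernelProb_Ev_false :
    Q.family.kernelProb 0 x (Ev Q x.length false) =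
      ((1 / 2 : ℝ) ^ Q.rho x.length * (1 / 2) ^ (S2 Q x.length).card) * plusW Q.R Q.p x := by
  rw [kernelProb_Ev, born_inEvent_false]

/-- **The probability of "all signs `1`"**: `κ · minusW`. [cite: Aaronson2005, Thm. 4 (proof)] -/
theorem kernelProb_Ev_true :
    Q.family.kernelProb 0 x (Ev Q x.length true) =
      ((1 / 2 : ℝ) ^ Q.rho x.length * (1 / 2) ^ (S2 Q x.length).card) * minusW Q.R Q.p x := by
  rw [kernelProb_Ev, born_inEvent_true]

/-- **Kernel probabilities of disjoint events add.** [cite: NielsenChuang2010, §2.2.5] -/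
theorem kernelProb_union (W : QCircuitFamily cliffordT) {A B : Set (List Bool)} (hAB : ∀ w, w ∈ A → w ∉ B) :
    W.kernelProb 0 x (A ∪ B) = W.kernelProb 0 x A + W.kernelProb 0 x B := by
  classical
  rw [kernelProb_eq_sum, kernelProb_eq_sum, kernelProb_eq_sum, ← Finset.sum_add_distrib]
  refine Finset.sum_congr rfl fun z _ => ?_
  by_cases hA : List.ofFn z ∈ A
  · rw [if_pos (Set.mem_union_left _ hA), if_pos hA, if_neg (hAB _ hA), add_zero]
  · by_cases hB : List.ofFn z ∈ B
    · rw [if_pos (Set.mem_union_right _ hB), if_neg hA, if_pos hB, zero_add]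
    · rw [if_neg (fun h => h.elim hA hB), if_neg hA, if_neg hB, add_zero]

/-- **The complement rule** `Pr[Eᶜ] = 1 - Pr[E]` (the output state is a unit vector).
[cite: NielsenChuang2010, §2.2.5] -/
theorem kernelProb_compl (W : QCircuitFamily cliffordT) (E : Set (List Bool)) :
    W.kernelProb 0 x Eᶜ = 1 - W.kernelProb 0 x E := by
  classical
  rw [kernelProb_eq_sum, kernelProb_eq_sum, eq_sub_iff_add_eq, ← Finset.sum_add_distrib]
  have h1 := QCircuit.normSq_runOn_basisState cliffordT_isUnitary_holds 0 (W.circ x.length) x.get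
  unfold normSq at h1
  rw [← h1]
  refine Finset.sum_congr rfl fun z _ => ?_
  by_cases hE : List.ofFn z ∈ E
  · rw [if_neg (fun h : List.ofFn z ∈ Eᶜ => h hE), if_pos hE, zero_add]
  · rw [if_pos (show List.ofFn z ∈ Eᶜ from hE), if_neg hE, add_zero]

/-- **The probability of "the signs are unanimous"**: `κ (plusW + minusW)`. [cite: Aaronson2005, Thm. 4 (proof)] -/
theorem kernelProb_Ev_union :
    Q.family.kernelProb 0 x (Ev Q x.length false ∪ Ev Q x.length true) =
      ((1 / 2 : ℝ) ^ Q.rho x.length * (1 / 2) ^ (S2 Q x.length).card) * (plusW Q.R Q.p x + minusW Q.R Q.p x) := by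
  rw [kernelProb_union x _ (fun l hl => not_mem_Ev_true_of_mem_Ev_false hl), kernelProb_Ev_false, kernelProb_Ev_true]
  ring

/-! ### The thresholds -/

/-- The post-selection weight is positive (for a `PP` witness: the gap is never `0`). [folklore] -/
theorem plusW_add_minusW_pos : 0 < plusW Q.R Q.p x + minusW Q.R Q.p x := by
  rcases lt_or_gt_of_ne (gapG_ne_zero (R := Q.R) (p := Q.p) x) with h | h
  · exact add_pos_of_nonneg_of_pos (plusW_nonneg x) (minusW_pos h)
  · exact add_pos_of_pos_of_nonneg (plusW_pos h) (minusW_nonneg x)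

/-- **Member side**: if `G_x > 0` then `plusW / (plusW + minusW) ≥ 2/3`. [cite: Aaronson2005, Thm. 4 (proof)] -/
theorem cond_ge_two_thirds (hG : 0 < gapG Q.R Q.p x) :
    2 / 3 ≤ plusW Q.R Q.p x / (plusW Q.R Q.p x + minusW Q.R Q.p x) :=
  two_thirds_le_div_add (plusW_pos hG) (minusW_nonneg x) (four_mul_minusW_le_plusW hG)

/-- **Non-member side**: if `G_x < 0` then `plusW / (plusW + minusW) ≤ 1/3`. [cite: Aaronson2005, Thm. 4 (proof)] -/
theorem cond_le_one_third (hG : gapG Q.R Q.p x < 0) :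
    plusW Q.R Q.p x / (plusW Q.R Q.p x + minusW Q.R Q.p x) ≤ 1 / 3 :=
  div_add_le_one_third (plusW_nonneg x) (minusW_pos hG) (four_mul_plusW_le_minusW hG)

end Core

end PPPostBQP

end Literature.Computability.QuantumComplexity

end
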